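import Mathlib
import Literature.NumberTheory.LFunctions.Zhang2022.SkeletonPartOne
import Literature.NumberTheory.LFunctions.Zhang2022.SkeletonAssembly
import Literature.NumberTheory.LFunctions.Zhang2022.Section3Lemma33
import Literature.NumberTheory.LFunctions.Zhang2022.Section3Lemma36
import HarnessLib

/-!
# Zhang (2022) §3, Lemma 3.5: the deduction `Lemma31 → Lemma33b → Lemma35` as a kernel EDGE

Topic `Literature/NumberTheory/LFunctions/Zhang2022` (Landau–Siegel adjudication tree;
verdict-neutral). Y. Zhang, *Discrete mean estimates and the Landau–Siegel zero*,
arXiv:2211.02515v1 (2022) [Zhang2022LandauSiegel] — **an unrefereed manuscript under adjudication**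
— §3, Lemma 3.5 (PDF p. 15, tex L825–L838; campaign DAG nodes `Z22:§3.u020`, `Z22:§3.u021`,
`Z22:Lem3.5`, `Z22:(3.5)`):

> Write `X₃(x,ψ) = Σ_{D⁴<n≤x} ν(n)ψ(n)n^{−s₀}` for `x > D⁴`. Assume that (A) holds. By Cauchy's
> inequality, the second assertion of Lemma 3.2 [print slip: Lemma 3.3] and Lemma 3.1,
> `Σ_{ψ∈Ψ} (|X₃(P²,ψ)| + ∫_{D⁴}^{P²} |X₃(x,ψ)| dx/x)² ≪ P²𝓛⁻¹⁹⁹³ ≪ 𝔓𝓛⁻¹⁹⁰⁹`. Thus we conclude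
> **Lemma 3.5.** Assume that (A) holds. The inequality
> `|X₃(P²,ψ)| + ∫_{D⁴}^{P²} |X₃(x,ψ)| dx/x < 𝓛⁻⁵⁸⁵`  (3.5)
> holds for all but at most `O(𝔓𝓛⁻⁷³⁹)` characters `ψ` in `Ψ`.

The typed skeleton states Lemma 3.5 as the CLAIM node `Skeleton.Lemma35` (`SkeletonPartOne.lean`,
the leaf `h35` of `Skeleton.theorem1_of_leaves`, feeding `Skeleton.prop21_of_lemmas`). This file
PROVES it, in the manuscript's own three steps and with visible constants:

* `sum_sq_add_integral_le` — the "Cauchy's inequality" step in general form: if a family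
  of step functions `F_i(⌊y⌋)` has second moment `Σ_i F_i(⌊y⌋)² ≤ K` at every height `y ∈ [a,b]`
  (`0 < a ≤ b`), then `Σ_i (F_i(⌊b⌋) + ∫_a^b F_i(⌊y⌋) dy/y)² ≤ (2 + 2 log²(b/a))·K`
  (Cauchy–Schwarz against `dy/y` is the tree's `Lemma36.sq_integral_div_le_log_mul_integral`);
* `lemma35_of` — **the deduction `Z22:§3.u021` ⇒ Lemma 3.5 as an EDGE of the DAG**:
  `Skeleton.Lemma31 → Skeleton.Lemma33b → Skeleton.Lemma35`. The large sieve (node `Lemma33b`,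
  constant `C₃₃`) at every height `≤ P²` bounds `Σ_{ψ∈Ψ} |X₃(x,ψ)|² ≤ C₃₃P²·W`,
  `W = Σ_{D⁴<n≤P²} |ν(n)|²/n`; Lemma 3.1 (node `Lemma31`, under (A)) gives `W ≤ C₃₁𝓛⁻²⁰¹¹`;
  `log(P²/D⁴) ≤ 2𝓛⁹`; and (2.9) in the tree's proved form `Zhang2022.frakP_bounds` gives
  `P² ≤ 2𝔓𝓛⁷⁷` (private helper here; the public statement is `Skeleton.bigP_sq_le_frakP` of
  `Section3Lemma35Holds`); whence the moment is `≤ 20C₃₁C₃₃·𝔓𝓛⁻¹⁹¹⁶ ≤ 20C₃₁C₃₃·𝔓𝓛⁻¹⁹⁰⁹`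
  (`Zhang2022.lemma35_moment_exponent`: `−1993 + 77 = −1916 ≤ −1909`) and, by finite Chebyshev
  (`Zhang2022.card_filter_le_div_sq`) at the threshold `𝓛⁻⁵⁸⁵`, at most
  `20C₃₁C₃₃·𝔓𝓛⁻⁷⁴⁶ ≤ 20C₃₁C₃₃·𝔓𝓛⁻⁷³⁹` members of `Ψ` violate (3.5)
  (`Zhang2022.lemma35_exponent`: `−1909 + 2·585 = −739`);
* The leaf itself, `Skeleton.lemma35_holds : Skeleton.Lemma35`, is the tree's
  `Section3Lemma35Holds.lean` (sz-d01, landed in the same gate batch); this file keeps only the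
  non-colliding EDGE `lemma35_of` and its lemmas (revision 2 removed the duplicate `lemma35_holds`
  and made the `P² ≤ 2𝔓𝓛⁷⁷` helper private, restoring the umbrella build).

No new definitions, no named facts; nothing here bears on Theorems 1–2 of the source or on
Landau–Siegel zeros.

## References

* Y. Zhang, arXiv:2211.02515v1 (2022), §3 Lemma 3.5, p. 15; (2.9) p. 5.
  [cite: Zhang2022LandauSiegel, Lemma 3.5 p.15]
-/

noncomputable section

open Finset Complex Real MeasureTheory

namespace Literature.NumberTheory.LFunctions.Zhang2022.Skeleton

/-! ## "By Cauchy's inequality": endpoint plus `dy/y`-average, squared, from a moment bound at every height -/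

/-- **The Cauchy–Schwarz step of Lemmas 3.4–3.6 in general form.** Let `F_i : ℕ → ℝ` (`i` in a
finite set `S`) and `0 < a ≤ b`. If `Σ_{i∈S} F_i(⌊y⌋)² ≤ K` for every `y ∈ [a,b]`, then
`Σ_{i∈S} (F_i(⌊b⌋) + ∫_a^b F_i(⌊y⌋) dy/y)² ≤ (2 + 2·log²(b/a))·K`:
`(u+v)² ≤ 2u² + 2v²`, the moment bound at height `b` for `u`, and for `v` Cauchy–Schwarz against
`dy/y` (`(∫_a^b g/y)² ≤ log(b/a)·∫_a^b g²/y`, the tree's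
`Lemma36.sq_integral_div_le_log_mul_integral`) followed by the moment bound under the integral.
This is the "By Cauchy's inequality" step of the displays preceding Lemmas 3.4, 3.5, 3.6 of the
source, isolated. [cite: Zhang2022LandauSiegel, §3 p.15, proof of Lemmas 3.4–3.6] -/
theorem sum_sq_add_integral_le {ι : Type*} (S : Finset ι) (F : ι → ℕ → ℝ) {a b K : ℝ}
    (ha : 0 < a) (hab : a ≤ b)
    (hK : ∀ y : ℝ, a ≤ y → y ≤ b → ∑ i ∈ S, F i ⌊y⌋₊ ^ 2 ≤ K) :
    ∑ i ∈ S, (F i ⌊b⌋₊ + ∫ y in a..b, F i ⌊y⌋₊ / y) ^ 2 ≤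
      (2 + 2 * Real.log (b / a) ^ 2) * K := by
  set L : ℝ := Real.log (b / a) with hLdef
  have hb : 0 < b := ha.trans_le hab
  have hL0 : 0 ≤ L := Real.log_nonneg ((one_le_div ha).mpr hab)
  have hLint : IntervalIntegrable (fun y : ℝ => y⁻¹) volume a b := by
    refine intervalIntegral.intervalIntegrable_inv (fun y hy => ?_) continuousOn_id
    rw [Set.uIcc_of_le hab] at hy
    exact (ha.trans_le hy.1).ne'
  -- the moment bound at the endpoint
  have hend : ∑ i ∈ S, F i ⌊b⌋₊ ^ 2 ≤ K := hK b hab le_rfl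
  -- Cauchy–Schwarz against `dy/y`, for each `i`
  have hCS : ∀ i, (∫ y in a..b, F i ⌊y⌋₊ / y) ^ 2 ≤ L * ∫ y in a..b, F i ⌊y⌋₊ ^ 2 / y :=
    fun i => Lemma36.sq_integral_div_le_log_mul_integral (fun y => F i ⌊y⌋₊) ha hab
      (Lemma36.intervalIntegrable_natFloor_div (F i) ha hab)
      (Lemma36.intervalIntegrable_natFloor_div (fun N => F i N ^ 2) ha hab)
  -- the integrated moment: swap the finite sum with the integral and bound pointwise
  have hint : ∑ i ∈ S, ∫ y in a..b, F i ⌊y⌋₊ ^ 2 / y ≤ K * L := by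
    have hswap : ∑ i ∈ S, ∫ y in a..b, F i ⌊y⌋₊ ^ 2 / y =
        ∫ y in a..b, (∑ i ∈ S, F i ⌊y⌋₊ ^ 2) / y := by
      rw [← intervalIntegral.integral_finsetSum fun i _ =>
        Lemma36.intervalIntegrable_natFloor_div (fun N => F i N ^ 2) ha hab]
      simp only [Finset.sum_div]
    rw [hswap]
    calc ∫ y in a..b, (∑ i ∈ S, F i ⌊y⌋₊ ^ 2) / y
        ≤ ∫ y in a..b, K * y⁻¹ := by
          refine intervalIntegral.integral_mono_on hab
            (Lemma36.intervalIntegrable_natFloor_div (fun N => ∑ i ∈ S, F i N ^ 2) ha hab)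
            (hLint.const_mul _) fun y hy => ?_
          rw [div_eq_mul_inv]
          exact mul_le_mul_of_nonneg_right (hK y hy.1 hy.2) (inv_nonneg.mpr (ha.trans_le hy.1).le)
      _ = K * L := by
          rw [intervalIntegral.integral_const_mul, integral_inv_of_pos ha hb]
  -- assembly
  calc ∑ i ∈ S, (F i ⌊b⌋₊ + ∫ y in a..b, F i ⌊y⌋₊ / y) ^ 2
      ≤ ∑ i ∈ S, (2 * F i ⌊b⌋₊ ^ 2 + 2 * L * ∫ y in a..b, F i ⌊y⌋₊ ^ 2 / y) := by
        refine Finset.sum_le_sum fun i _ => ?_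
        nlinarith [hCS i, sq_nonneg (F i ⌊b⌋₊ - ∫ y in a..b, F i ⌊y⌋₊ / y)]
    _ = 2 * (∑ i ∈ S, F i ⌊b⌋₊ ^ 2) + 2 * L * ∑ i ∈ S, ∫ y in a..b, F i ⌊y⌋₊ ^ 2 / y := by
        rw [Finset.sum_add_distrib, ← Finset.mul_sum, ← Finset.mul_sum]
    _ ≤ 2 * K + 2 * L * (K * L) :=
        add_le_add (mul_le_mul_of_nonneg_left hend zero_le_two)
          (mul_le_mul_of_nonneg_left hint (mul_nonneg zero_le_two hL0))
    _ = (2 + 2 * L ^ 2) * K := by ring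

/-! ## Small facts about the parameters (`Re s₀ = 1/2` is the tree's `Skeleton.s0_re`) -/

/-- `𝓛 ≥ 2` for `D ≥ 8` (`e² < 8`). [cite: Zhang2022LandauSiegel, §2 (2.1)] -/
private theorem two_le_ell {D : ℕ} (hD : 8 ≤ D) : 2 ≤ ell D := by
  have hD' : (8 : ℝ) ≤ D := by exact_mod_cast hD
  have h8 : Real.exp 2 < 8 := by
    have := Real.exp_one_lt_d9
    have h : Real.exp 2 = Real.exp 1 * Real.exp 1 := by rw [← Real.exp_add]; norm_num
    rw [h]; nlinarith [Real.exp_pos 1]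
  rw [ell, Real.le_log_iff_exp_le (by linarith)]
  linarith

/-- `P² = exp(2𝓛⁹)`. [cite: Zhang2022LandauSiegel, §2 (2.6)] -/
private theorem bigP_sq_eq_exp_two (D : ℕ) : bigP D ^ 2 = Real.exp (2 * ell D ^ 9) := by
  rw [bigP, ← Real.exp_nat_mul]; norm_num

/-- `D⁴ ≤ P²` once `𝓛 ≥ 2` (`D⁴ = exp(4𝓛)`, `P² = exp(2𝓛⁹)`, `4𝓛 ≤ 2𝓛⁹`).
[cite: Zhang2022LandauSiegel, §2 (2.6)] -/
private theorem natCast_pow_four_le_bigP_sq {D : ℕ} (hD : 8 ≤ D) : (D : ℝ) ^ 4 ≤ bigP D ^ 2 := by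
  have hℓ := two_le_ell hD
  have hD0 : (0 : ℝ) < D := by exact_mod_cast (show 0 < D by omega)
  have h4 : (D : ℝ) ^ 4 = Real.exp (4 * ell D) := by
    rw [ell, show (4 : ℝ) * Real.log D = Real.log ((D : ℝ) ^ 4) by
      rw [Real.log_pow]; norm_num, Real.exp_log (by positivity)]
  rw [h4, bigP_sq_eq_exp_two, Real.exp_le_exp]
  have h8 : (2 : ℝ) ^ 8 ≤ ell D ^ 8 := pow_le_pow_left₀ (by norm_num) hℓ 8
  nlinarith [h8]

/-- `log(P²/D⁴) ≤ 2𝓛⁹` for `D ≥ 8`. [cite: Zhang2022LandauSiegel, §2 (2.6)] -/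
private theorem log_bigP_sq_div_le {D : ℕ} (hD : 8 ≤ D) :
    Real.log (bigP D ^ 2 / (D : ℝ) ^ 4) ≤ 2 * ell D ^ 9 := by
  have hD1 : (1 : ℝ) ≤ (D : ℝ) ^ 4 := one_le_pow₀ (by exact_mod_cast (show 1 ≤ D by omega))
  have hP : 0 < bigP D ^ 2 := by rw [bigP_sq_eq_exp_two]; exact Real.exp_pos _
  calc Real.log (bigP D ^ 2 / (D : ℝ) ^ 4) ≤ Real.log (bigP D ^ 2) :=
        Real.log_le_log (div_pos hP (by positivity)) (div_le_self hP.le hD1)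
    _ = 2 * ell D ^ 9 := by rw [bigP_sq_eq_exp_two, Real.log_exp]

/-- **(2.9) as used here: `P² ≤ 2𝔓𝓛⁷⁷` for all large `D`** — from the tree's proved form of (2.9),
`Zhang2022.frakP_bounds` (`|𝔓 − P²𝓛⁻⁷⁷| ≤ 3𝓛⁻⁶⁸·P²𝓛⁻⁷⁷`), once `3𝓛⁻⁶⁸ ≤ 1/2`. (Private: the public
form is `Skeleton.bigP_sq_le_frakP` in `Section3Lemma35Holds`.) [cite: Zhang2022LandauSiegel, §2 (2.9)] -/
private theorem bigP_sq_le_two_frakP : ∃ D₀ : ℕ, ∀ D : ℕ, D₀ ≤ D →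
    bigP D ^ 2 ≤ 2 * frakP D * ell D ^ 77 := by
  obtain ⟨D₀, h⟩ := frakP_bounds
  refine ⟨max D₀ 8, fun D hD => ?_⟩
  have hD₀ : D₀ ≤ D := le_trans (le_max_left _ _) hD
  have hD8 : 8 ≤ D := le_trans (le_max_right _ _) hD
  have hℓ : 2 ≤ ell D := two_le_ell hD8
  have hb : |frakP D - bigP D ^ 2 * (ell D ^ 77)⁻¹| ≤
      3 * (ell D ^ 68)⁻¹ * (bigP D ^ 2 * (ell D ^ 77)⁻¹) := by
    have h' := h D hD₀
    have hP2 : Real.exp (Real.log D ^ 9) ^ 2 = bigP D ^ 2 := by rw [bigP, ell]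
    rw [hP2] at h'
    exact h'
  have hℓ0 : 0 < ell D := by linarith
  have hX0 : 0 ≤ bigP D ^ 2 * (ell D ^ 77)⁻¹ := by positivity
  -- `3𝓛⁻⁶⁸ ≤ 1/2`
  have h68 : 3 * (ell D ^ 68)⁻¹ ≤ 1 / 2 := by
    have h6 : (6 : ℝ) ≤ ell D ^ 68 := by
      have : (2 : ℝ) ^ 68 ≤ ell D ^ 68 := pow_le_pow_left₀ (by norm_num) hℓ 68
      nlinarith
    rw [show 3 * (ell D ^ 68)⁻¹ = 3 / ell D ^ 68 by ring, div_le_iff₀ (by positivity)]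
    linarith
  have hlow : bigP D ^ 2 * (ell D ^ 77)⁻¹ / 2 ≤ frakP D := by
    have h1 : bigP D ^ 2 * (ell D ^ 77)⁻¹ - frakP D ≤
        3 * (ell D ^ 68)⁻¹ * (bigP D ^ 2 * (ell D ^ 77)⁻¹) := by
      rw [abs_sub_comm] at hb
      exact le_trans (le_abs_self _) hb
    nlinarith [mul_le_mul_of_nonneg_right h68 hX0]
  calc bigP D ^ 2 = bigP D ^ 2 * (ell D ^ 77)⁻¹ * ell D ^ 77 := by field_simp
    _ ≤ 2 * frakP D * ell D ^ 77 := by nlinarith [pow_pos hℓ0 77]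

/-! ## Lemma 3.1's sum is the real weight `W = Σ |ν(n)|²/n` -/

/-- For real `χ` (`χ² = 1`), `ν(n)²/n` summed over a range has norm `Σ |ν(n)|² n⁻¹` (each `ν(n)` is
real, so `ν(n)² = |ν(n)|²`; the tree's `Lemma31.divisorSumChar_sq_eq`).
[cite: Zhang2022LandauSiegel, §3 Lemma 3.1] -/
theorem norm_sum_nu_sq_div_eq {D : ℕ} [NeZero D] (χ : DirichletCharacter ℂ D) (hχ : χ ^ 2 = 1)
    (T : Finset ℕ) :
    ‖∑ n ∈ T, nu χ n ^ 2 / (n : ℂ)‖ = ∑ n ∈ T, ‖nu χ n‖ ^ 2 * (n : ℝ) ^ (-1 : ℝ) := by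
  have hterm : ∀ n ∈ T, nu χ n ^ 2 / (n : ℂ) = ((‖nu χ n‖ ^ 2 * (n : ℝ) ^ (-1 : ℝ) : ℝ) : ℂ) := by
    intro n _
    rw [nu, Lemma31.divisorSumChar_sq_eq χ hχ n, Real.rpow_neg_one]
    push_cast
    rw [div_eq_mul_inv]
  rw [Finset.sum_congr rfl hterm, ← Complex.ofReal_sum, Complex.norm_real, Real.norm_eq_abs,
    abs_of_nonneg (Finset.sum_nonneg fun n _ => by positivity)]

/-! ## The mean square of `X₃` at every height, from the large sieve (node `Lemma33b`) -/

/-- **`Σ_{ψ∈Ψ} |X₃(y,ψ)|² ≤ C₃₃·P²·W` for every `y ≤ P²`**, `W = Σ_{D⁴<n≤P²} |ν(n)|²/n`: the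
second assertion of Lemma 3.3 (node `Skeleton.Lemma33b`, constant `C₃₃`) applied to the
coefficients `ν(n)·1_{D⁴<n≤⌊y⌋}` at `s = s₀` (`Re s₀ = 1/2`). [cite: Zhang2022LandauSiegel, Lemma 3.5 p.15] -/
theorem sum_norm_X3_sq_le {C : ℝ} (h33 : ∀ (D : ℕ) (s : ℂ) (c : ℕ → ℂ),
      ∑ᶠ x : Chr D, ‖∑ n ∈ Finset.Icc 1 ⌊bigP D ^ 2⌋₊, c n * x.ψ (n : ZMod x.p) * (n : ℂ) ^ (-s)‖ ^ 2
        ≤ C * bigP D ^ 2 * ∑ n ∈ Finset.Icc 1 ⌊bigP D ^ 2⌋₊, ‖c n‖ ^ 2 * (n : ℝ) ^ (-2 * s.re))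
    {D : ℕ} [NeZero D] [Fintype (Chr D)] (χ : DirichletCharacter ℂ D) {y : ℝ} (hy : y ≤ bigP D ^ 2) :
    ∑ x : Chr D, ‖X3 χ x y‖ ^ 2 ≤
      max C 0 * bigP D ^ 2 *
        ∑ n ∈ Finset.Ioc (D ^ 4) ⌊bigP D ^ 2⌋₊, ‖nu χ n‖ ^ 2 * (n : ℝ) ^ (-1 : ℝ) := by
  classical
  have hNB : ⌊y⌋₊ ≤ ⌊bigP D ^ 2⌋₊ := Nat.floor_mono hy
  obtain ⟨c, hc⟩ : ∃ c : ℕ → ℂ, c = fun n => if n ∈ Finset.Ioc (D ^ 4) ⌊y⌋₊ then nu χ n else 0 :=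
    ⟨_, rfl⟩
  have hc_in : ∀ n ∈ Finset.Ioc (D ^ 4) ⌊y⌋₊, c n = nu χ n := fun n hn => by
    rw [hc]; exact if_pos hn
  have hc_out : ∀ n, n ∉ Finset.Ioc (D ^ 4) ⌊y⌋₊ → c n = 0 := fun n hn => by
    rw [hc]; exact if_neg hn
  have hsub : Finset.Ioc (D ^ 4) ⌊y⌋₊ ⊆ Finset.Icc 1 ⌊bigP D ^ 2⌋₊ := fun n hn => by
    rw [Finset.mem_Ioc] at hn; rw [Finset.mem_Icc]; omega
  have key := h33 D (s0 D) c
  rw [finsum_eq_sum_of_fintype] at key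
  -- the left side is `Σ_ψ |X₃(y,ψ)|²`
  have hL : ∀ x : Chr D,
      ∑ n ∈ Finset.Icc 1 ⌊bigP D ^ 2⌋₊, c n * x.ψ (n : ZMod x.p) * (n : ℂ) ^ (-s0 D) =
        X3 χ x y := by
    intro x
    rw [X3, ← Finset.sum_subset hsub]
    · exact Finset.sum_congr rfl fun n hn => by rw [hc_in n hn]
    · intro n _ hn
      rw [hc_out n hn, zero_mul, zero_mul]
  -- the right side is at most `W`
  have hR : ∑ n ∈ Finset.Icc 1 ⌊bigP D ^ 2⌋₊, ‖c n‖ ^ 2 * (n : ℝ) ^ (-2 * (s0 D).re) ≤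
      ∑ n ∈ Finset.Ioc (D ^ 4) ⌊bigP D ^ 2⌋₊, ‖nu χ n‖ ^ 2 * (n : ℝ) ^ (-1 : ℝ) := by
    rw [s0_re, show (-2 : ℝ) * (1 / 2) = -1 by norm_num, ← Finset.sum_subset hsub]
    · calc ∑ n ∈ Finset.Ioc (D ^ 4) ⌊y⌋₊, ‖c n‖ ^ 2 * (n : ℝ) ^ (-1 : ℝ)
          = ∑ n ∈ Finset.Ioc (D ^ 4) ⌊y⌋₊, ‖nu χ n‖ ^ 2 * (n : ℝ) ^ (-1 : ℝ) :=
            Finset.sum_congr rfl fun n hn => by rw [hc_in n hn]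
        _ ≤ ∑ n ∈ Finset.Ioc (D ^ 4) ⌊bigP D ^ 2⌋₊, ‖nu χ n‖ ^ 2 * (n : ℝ) ^ (-1 : ℝ) :=
            Finset.sum_le_sum_of_subset_of_nonneg (Finset.Ioc_subset_Ioc le_rfl hNB)
              fun n _ _ => by positivity
    · intro n _ hn
      rw [hc_out n hn, norm_zero]
      simp
  simp only [hL] at key
  have hP : 0 ≤ bigP D ^ 2 := sq_nonneg _
  have hc0 : 0 ≤ ∑ n ∈ Finset.Icc 1 ⌊bigP D ^ 2⌋₊, ‖c n‖ ^ 2 * (n : ℝ) ^ (-2 * (s0 D).re) :=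
    Finset.sum_nonneg fun n _ => by positivity
  calc ∑ x : Chr D, ‖X3 χ x y‖ ^ 2
      ≤ C * bigP D ^ 2 *
          ∑ n ∈ Finset.Icc 1 ⌊bigP D ^ 2⌋₊, ‖c n‖ ^ 2 * (n : ℝ) ^ (-2 * (s0 D).re) := key
    _ ≤ max C 0 * bigP D ^ 2 *
          ∑ n ∈ Finset.Icc 1 ⌊bigP D ^ 2⌋₊, ‖c n‖ ^ 2 * (n : ℝ) ^ (-2 * (s0 D).re) := by
        gcongr; exact le_max_left _ _
    _ ≤ max C 0 * bigP D ^ 2 *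
          ∑ n ∈ Finset.Ioc (D ^ 4) ⌊bigP D ^ 2⌋₊, ‖nu χ n‖ ^ 2 * (n : ℝ) ^ (-1 : ℝ) :=
        mul_le_mul_of_nonneg_left hR (mul_nonneg (le_max_right _ _) hP)

/-! ## Lemma 3.5 -/

/-- **§3 p. 15, `Z22:§3.u021` ⇒ Lemma 3.5, as an edge of the DAG: `Lemma31 → Lemma33b → Lemma35`.**
"By Cauchy's inequality, the second assertion of Lemma 3.3 and Lemma 3.1,
`Σ_{ψ∈Ψ}(|X₃(P²,ψ)| + ∫_{D⁴}^{P²}|X₃(x,ψ)|dx/x)² ≪ P²𝓛⁻¹⁹⁹³ ≪ 𝔓𝓛⁻¹⁹⁰⁹`. Thus we conclude Lemma 3.5."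
With `C₃₁`, `C₃₃` the constants of the two input nodes the moment is
`≤ (2 + 2log²(P²/D⁴))·C₃₃P²·C₃₁𝓛⁻²⁰¹¹ ≤ 10𝓛¹⁸·C₃₃·2𝔓𝓛⁷⁷·C₃₁𝓛⁻²⁰¹¹ = 20C₃₁C₃₃·𝔓𝓛⁻¹⁹¹⁶`
(`P² ≤ 2𝔓𝓛⁷⁷`, i.e. (2.9)), and Chebyshev at `𝓛⁻⁵⁸⁵` leaves at most
`20C₃₁C₃₃·𝔓𝓛⁻⁷⁴⁶ ≤ 20C₃₁C₃₃·𝔓𝓛⁻⁷³⁹` exceptions. Kernel-checked.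
[cite: Zhang2022LandauSiegel, Lemma 3.5 p.15] -/
theorem lemma35_of (h31 : Lemma31) (h33b : Lemma33b) : Lemma35 := by
  classical
  obtain ⟨C₁, D₁, h1⟩ := h31
  obtain ⟨C₃, h3⟩ := h33b
  obtain ⟨D₂, h2⟩ := bigP_sq_le_two_frakP
  refine ⟨20 * max C₁ 0 * max C₃ 0, max (max D₁ D₂) 8, fun D _ χ hD hq hp hA => ?_⟩
  have hD₁ : D₁ ≤ D := le_trans (le_trans (le_max_left _ _) (le_max_left _ _)) hD
  have hD₂ : D₂ ≤ D := le_trans (le_trans (le_max_right _ _) (le_max_left _ _)) hD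
  have hD8 : 8 ≤ D := le_trans (le_max_right _ _) hD
  haveI : Fintype (Chr D) := Fintype.ofFinite (Chr D)
  -- the external inputs, instantiated at this `D`, `χ` (before any abbreviation)
  have hWraw := h1 D χ hD₁ hq hp hA
  rw [norm_sum_nu_sq_div_eq χ hq.sq_eq_one] at hWraw
  have hMSraw : ∀ y : ℝ, y ≤ bigP D ^ 2 → ∑ x : Chr D, ‖X3 χ x y‖ ^ 2 ≤
      max C₃ 0 * bigP D ^ 2 *
        ∑ n ∈ Finset.Ioc (D ^ 4) ⌊bigP D ^ 2⌋₊, ‖nu χ n‖ ^ 2 * (n : ℝ) ^ (-1 : ℝ) :=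
    fun y hy => sum_norm_X3_sq_le h3 χ hy
  have hP2le : bigP D ^ 2 ≤ 2 * frakP D * ell D ^ 77 := h2 D hD₂
  have hab : (D : ℝ) ^ 4 ≤ bigP D ^ 2 := natCast_pow_four_le_bigP_sq hD8
  have hlog9 : Real.log (bigP D ^ 2 / (D : ℝ) ^ 4) ≤ 2 * ell D ^ 9 := log_bigP_sq_div_le hD8
  have hℓ2 : 2 ≤ ell D := two_le_ell hD8
  have hFX : ∀ (x : Chr D) (y : ℝ), ‖X3 χ x y‖ =
      (fun (x : Chr D) (N : ℕ) =>
        ‖∑ n ∈ Finset.Ioc (D ^ 4) N, nu χ n * x.ψ (n : ZMod x.p) * (n : ℂ) ^ (-s0 D)‖) x ⌊y⌋₊ :=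
    fun x y => rfl
  -- notation
  set ℓ : ℝ := ell D with hℓdef
  set P2 : ℝ := bigP D ^ 2 with hP2def
  set a : ℝ := (D : ℝ) ^ 4 with hadef
  set W : ℝ := ∑ n ∈ Finset.Ioc (D ^ 4) ⌊P2⌋₊, ‖nu χ n‖ ^ 2 * (n : ℝ) ^ (-1 : ℝ) with hWdef
  set F : Chr D → ℕ → ℝ := fun x N =>
    ‖∑ n ∈ Finset.Ioc (D ^ 4) N, nu χ n * x.ψ (n : ZMod x.p) * (n : ℂ) ^ (-s0 D)‖ with hFdef
  have hℓ1 : 1 ≤ ℓ := by linarith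
  have hℓ0 : 0 < ℓ := by linarith
  have ha0 : 0 < a := by positivity
  have hC₁ : 0 ≤ max C₁ 0 := le_max_right _ _
  have hC₃ : 0 ≤ max C₃ 0 := le_max_right _ _
  have hW0 : 0 ≤ W := Finset.sum_nonneg fun n _ => by positivity
  have hfrakP : 0 ≤ frakP D := by
    rw [frakP_eq_sum_primeWindow]; exact Finset.sum_nonneg fun p _ => Nat.cast_nonneg p
  -- (1) Lemma 3.1: `W ≤ C₃₁ 𝓛⁻²⁰¹¹`
  have hW : W ≤ max C₁ 0 / ℓ ^ 2011 :=
    hWraw.trans (div_le_div_of_nonneg_right (le_max_left _ _) (by positivity))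
  -- (2)+(3) the large sieve at every height and Cauchy: the second moment of the left side of (3.5)
  have hmom : ∑ x : Chr D, (F x ⌊P2⌋₊ + ∫ y in a..P2, F x ⌊y⌋₊ / y) ^ 2 ≤
      (2 + 2 * Real.log (P2 / a) ^ 2) * (max C₃ 0 * P2 * W) := by
    refine sum_sq_add_integral_le Finset.univ F ha0 hab fun y _ hy2 => ?_
    have h := hMSraw y hy2
    simp only [hFX] at h
    exact h
  -- (4) sizes: `2 + 2log²(P²/D⁴) ≤ 10𝓛¹⁸`, `P² ≤ 2𝔓𝓛⁷⁷`
  have hlog : 2 + 2 * Real.log (P2 / a) ^ 2 ≤ 10 * ℓ ^ 18 := by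
    have h0 : 0 ≤ Real.log (P2 / a) := Real.log_nonneg ((one_le_div ha0).mpr hab)
    have h18 : Real.log (P2 / a) ^ 2 ≤ (2 * ℓ ^ 9) ^ 2 := pow_le_pow_left₀ h0 hlog9 2
    have h1 : (1 : ℝ) ≤ ℓ ^ 18 := one_le_pow₀ hℓ1
    nlinarith
  have hmom' : ∑ x : Chr D, (F x ⌊P2⌋₊ + ∫ y in a..P2, F x ⌊y⌋₊ / y) ^ 2 ≤
      20 * max C₁ 0 * max C₃ 0 * frakP D * (ℓ ^ 18 * ℓ ^ 77 / ℓ ^ 2011) := by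
    calc ∑ x : Chr D, (F x ⌊P2⌋₊ + ∫ y in a..P2, F x ⌊y⌋₊ / y) ^ 2
        ≤ (2 + 2 * Real.log (P2 / a) ^ 2) * (max C₃ 0 * P2 * W) := hmom
      _ ≤ (10 * ℓ ^ 18) * (max C₃ 0 * (2 * frakP D * ℓ ^ 77) * (max C₁ 0 / ℓ ^ 2011)) := by
          have hK : 0 ≤ max C₃ 0 * P2 * W := by positivity
          refine mul_le_mul hlog ?_ hK (by positivity)
          exact mul_le_mul (mul_le_mul_of_nonneg_left hP2le hC₃) hW hW0 (by positivity)
      _ = 20 * max C₁ 0 * max C₃ 0 * frakP D * (ℓ ^ 18 * ℓ ^ 77 / ℓ ^ 2011) := by ring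
  have hpow : ℓ ^ 18 * ℓ ^ 77 / ℓ ^ 2011 = (ℓ ^ 1916)⁻¹ := by
    field_simp
  rw [hpow] at hmom'
  -- (5) Chebyshev at the threshold `V = 𝓛⁻⁵⁸⁵`
  have hV : 0 < (ℓ ^ 585)⁻¹ := by positivity
  have hset : ({x : Chr D | ¬ Ineq35 χ x} : Set (Chr D)) =
      ↑(Finset.univ.filter fun x : Chr D =>
        (ℓ ^ 585)⁻¹ ≤ F x ⌊P2⌋₊ + ∫ y in a..P2, F x ⌊y⌋₊ / y) := by
    ext x
    simp only [Set.mem_setOf_eq, Finset.coe_filter, Finset.mem_univ, true_and, Ineq35, not_lt,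
      hFX]
    exact Iff.rfl
  rw [hset, Set.ncard_coe_finset]
  have hcount := card_filter_le_div_sq Finset.univ
    (fun x : Chr D => F x ⌊P2⌋₊ + ∫ y in a..P2, F x ⌊y⌋₊ / y) hV hmom'
  refine hcount.trans ?_
  -- `(20 C₁C₃ 𝔓 𝓛⁻¹⁹¹⁶) / 𝓛⁻¹¹⁷⁰ = 20 C₁C₃ 𝔓 𝓛⁻⁷⁴⁶ ≤ 20 C₁C₃ 𝔓 𝓛⁻⁷³⁹`
  have hK0 : 0 ≤ 20 * max C₁ 0 * max C₃ 0 * frakP D := by positivity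
  have e : 20 * max C₁ 0 * max C₃ 0 * frakP D * (ℓ ^ 1916)⁻¹ / ((ℓ ^ 585)⁻¹) ^ 2 =
      20 * max C₁ 0 * max C₃ 0 * frakP D * (ℓ ^ 746)⁻¹ := by
    field_simp
  rw [e]
  have h746 : (ℓ ^ 746)⁻¹ ≤ (ℓ ^ 739)⁻¹ :=
    inv_anti₀ (by positivity) (pow_le_pow_right₀ hℓ1 (by norm_num))
  exact mul_le_mul_of_nonneg_left h746 hK0

end Literature.NumberTheory.LFunctions.Zhang2022.Skeleton

end
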